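import Mathlib
import HarnessLib
import Summits.CriticalPhenomena.PercolationContinuityZ3.Theses.PercShatteringRace
import Summits.CriticalPhenomena.PercolationContinuityZ3.Theses.PercAnnulusCrossing

/-!
# Sketch — crux-ideate stmt-CriticalPhenomena-5785 (ideator 2), card `critical-orange-peeling`

Statements only (no proofs claimed). The crux `NearLinearTwoClusterDecay` = U(1/6) is
`Tendsto (fun n => P_{p_c}(twoClusterBox n ⌈n^{7/6}⌉)) atTop (𝓝 0)` (checked below by `Iff.rfl`).

* `ShellProduct`      — FIRST LEMMA: independence of disjoint shells gives
                         `P(twoClusterBox n (R K)) ≤ ∏_{k<K} P(shellTwoCluster (R k) (R (k+1)))`.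
* `ShellNonCertainty` — the transfer C⁺ (bounded aspect, constant level).
* `Transfer`          — C⁺ → crux;  `XBClosesU` — PercAnnulusCrossing.CritAnnulusNonCrossing → crux.
* `MergeOrDie` (pairwise jump-world sub-atom, implied by C⁺), `UTyp`, `TransferTyp`,
  `UTypCloses` — the typical-pair form and the route-level remark that it suffices for the glue.
-/

namespace Summit.CriticalPhenomena.PercolationContinuityZ3.Cruxes.NearLinearTwoClusterDecay.CriticalOrangePeeling

open Literature.Probability.LatticeModels Literature.Probability.Percolation

noncomputable section

/-- The critical bond measure on `ℤ³`. -/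
abbrev Pc : MeasureTheory.Measure (BondConfig (Site 3)) := bondPercolation (zdGraph 3) (criticalProbI 3)

/-- The crux event with inner radius `n` and outer radius `m`: two clusters of `ω|Λ(m)`, distinct
inside `Λ(m)`, each joining `Λ(n)` to `∂ⁱⁿΛ(m)` (same encoding as the route decl). -/
def twoClusterBox (n m : ℕ) : Set (BondConfig (Site 3)) :=
  {ω | ∃ x ∈ box 3 n, ∃ x' ∈ box 3 n, ∃ y ∈ innerBoundary (zdGraph 3) (box 3 m),
    ∃ y' ∈ innerBoundary (zdGraph 3) (box 3 m),
    ω ∈ openConnIn (↑(box 3 m) : Set (Site 3)) x y ∧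
    ω ∈ openConnIn (↑(box 3 m) : Set (Site 3)) x' y' ∧
    ω ∉ openConnIn (↑(box 3 m) : Set (Site 3)) x x'}

/-- The shell `Λ(R') \ Λ(R)` as a vertex set (sup-norm layers `R+1, …, R'`). -/
def shell (R R' : ℕ) : Set (Site 3) := (↑(box 3 R') : Set (Site 3)) \ ↑(box 3 R)

/-- The inner layer of the shell: vertices of sup-norm exactly `R + 1`. -/
def innerLayer (R : ℕ) : Set (Site 3) := shell R (R + 1)

/-- Shell two-cluster event: two clusters of the configuration restricted to the shell (paths
with all vertices in the shell), distinct inside the shell, each joining the inner layer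
(sup-norm `R+1`) to `∂ⁱⁿΛ(R')` (sup-norm `R'`). -/
def shellTwoCluster (R R' : ℕ) : Set (BondConfig (Site 3)) :=
  {ω | ∃ u ∈ innerLayer R, ∃ u' ∈ innerLayer R, ∃ v ∈ innerBoundary (zdGraph 3) (box 3 R'),
    ∃ v' ∈ innerBoundary (zdGraph 3) (box 3 R'),
    ω ∈ openConnIn (shell R R') u v ∧ ω ∈ openConnIn (shell R R') u' v' ∧
    ω ∉ openConnIn (shell R R') u u'}

/-- **FIRST LEMMA (dyadic-shell product; provable now).** For any parameter `p`, inner radius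
`n ≤ R 0` and increasing radii `R`, the two-cluster box event up to radius `R K` is contained in the
intersection of the `K` shell events, which are independent (disjoint edge sets):
`P_p(twoClusterBox n (R K)) ≤ ∏_{k<K} P_p(shellTwoCluster (R k) (R (k+1)))`. -/
def ShellProduct : Prop :=
  ∀ (p : unitInterval) (n K : ℕ) (R : ℕ → ℕ), n ≤ R 0 → StrictMono R →
    (bondPercolation (zdGraph 3) p).real (twoClusterBox n (R K)) ≤
      ∏ k ∈ Finset.range K, (bondPercolation (zdGraph 3) p).real (shellTwoCluster (R k) (R (k + 1)))

/-- **Transfer C⁺ (ShellNonCertainty).** At `p_c`, two shell-distinct crossing clusters of the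
aspect-2 shell `(N, 2N+2)` are NOT asymptotically certain. -/
def ShellNonCertainty : Prop :=
  ∃ ε : ℝ, 0 < ε ∧ ∀ᶠ N : ℕ in Filter.atTop, (Pc).real (shellTwoCluster N (2 * N + 2)) ≤ 1 - ε

/-- C⁺ implies the crux (indeed U(b) for every `b > 0`): `K ≈ (1/6) log₂ n` factors `≤ 1 - ε`. -/
def Transfer : Prop := ShellNonCertainty → Theses.PercShatteringRace.NearLinearTwoClusterDecay

/-- Route `PercAnnulusCrossing`'s crux X_B closes this crux for free:
`shellTwoCluster R (2R+2) ⊆ {Λ(R+1) ↔ ∂ⁱⁿΛ(2(R+1)) in Λ(2(R+1))}` and the product lemma. -/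
def XBClosesU : Prop :=
  Theses.PercAnnulusCrossing.CritAnnulusNonCrossing → Theses.PercShatteringRace.NearLinearTwoClusterDecay

/-- Sanity check: the route decl is literally the `⌈n^{7/6}⌉` instance of `twoClusterBox`. -/
example : Theses.PercShatteringRace.NearLinearTwoClusterDecay ↔
    Filter.Tendsto (fun n : ℕ => (Pc).real (twoClusterBox n ⌈(n : ℝ) ^ ((7 : ℝ) / 6)⌉₊))
      Filter.atTop (nhds 0) := Iff.rfl

/-- **MergeOrDie(ε)** — the conditional (Grimmett 1999, Lemma (7.89)-style) per-shell atom with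
ARBITRARY disjoint source sets `T₁, T₂` on the inner layer: with probability `≥ ε`, one source
fails to cross the shell or the two sources are joined inside the shell.
`ShellNonCertainty → MergeOrDie`. -/
def MergeOrDie : Prop :=
  ∃ ε : ℝ, 0 < ε ∧ ∀ᶠ N : ℕ in Filter.atTop, ∀ T₁ T₂ : Set (Site 3),
    T₁ ⊆ innerLayer N → T₂ ⊆ innerLayer N → Disjoint T₁ T₂ →
    (Pc).real {ω | (∃ u ∈ T₁, ∃ v ∈ innerBoundary (zdGraph 3) (box 3 (2 * N + 2)),
                      ω ∈ openConnIn (shell N (2 * N + 2)) u v) ∧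
                   (∃ u ∈ T₂, ∃ v ∈ innerBoundary (zdGraph 3) (box 3 (2 * N + 2)),
                      ω ∈ openConnIn (shell N (2 * N + 2)) u v) ∧
                   ¬ (∃ u ∈ T₁, ∃ v ∈ T₂, ω ∈ openConnIn (shell N (2 * N + 2)) u v)} ≤ 1 - ε

/-- The TYPICAL-PAIR form of the crux (route-level remark F4 of NOTES.md): two points of the
infinite cluster at distance `≤ n` are joined inside `Λ(⌈n^{7/6}⌉)`; vacuous when `θ(p_c) = 0`. -/
def UTyp : Prop :=
  ∀ ε : ℝ, 0 < ε → ∀ᶠ n : ℕ in Filter.atTop, ∀ y ∈ box 3 n,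
    (Pc).real (percolatesAt 0 ∩ percolatesAt y ∩
      (openConnIn (↑(box 3 ⌈(n : ℝ) ^ ((7 : ℝ) / 6)⌉₊) : Set (Site 3)) 0 y)ᶜ) ≤ ε

/-- C⁺ implies the pairwise atom (on `(shellTwoCluster N (2N+2))ᶜ` all shell-crossing clusters from
the inner layer coincide, so two disjoint crossing sources are joined): provable now, ~20 lines.
MergeOrDie is the natural jump-world SUB-atom of C⁺; it is NOT claimed to imply the crux or
`UTyp` by itself (the conditional peeling bound is `P(D_{k+1} | F_k) ≤ 1_{D_k} · g_k(E_k)` with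
`g_k(E) = P(two shell-distinct internal crossings starting in E)`, monotone in the exit set `E`,
whose supremum over `E` is the unconditional shell event). -/
def ShellNonCertaintyImpliesMergeOrDie : Prop := ShellNonCertainty → MergeOrDie

/-- C⁺ also gives the typical-pair form directly (fixed pair, same product, no union bound). -/
def TransferTyp : Prop := ShellNonCertainty → UTyp

/-- The crux implies its typical-pair form (first-exit argument of `JumpUniquenessBoxLRO`). -/
def CruxImpliesUTyp : Prop := Theses.PercShatteringRace.NearLinearTwoClusterDecay → UTyp

/-- UTyp suffices for the route's glue: S(1/2) ∧ UTyp(1/6) → θ(p_c) = 0 (RaceLemma minus first exit: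
`P(0 ↔ y in Λ_R) ≥ P(0,y ∈ I) - ε ≥ θ² - ε` by Harris–FKG). -/
def UTypCloses : Prop :=
  Theses.PercShatteringRace.FreeSusceptibilityPowerSaving → UTyp → _root_.PercolationContinuityZ3

end

end Summit.CriticalPhenomena.PercolationContinuityZ3.Cruxes.NearLinearTwoClusterDecay.CriticalOrangePeeling
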